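import Summits.BirchSwinnertonDyer.BirchSwinnertonDyer.Theorems.SignedLowerHalvesSmallImageLowerHalfBothSignsRttD2LambdaSpecialisationO
import Literature.NumberTheory.ComplexMultiplication.EllipticUnits.ImaginaryQuadraticMainConjectureAllPrimes
import HarnessLib

/-!
# Route `SignedLowerHalves`, crux L `SmallImageLowerHalfBothSigns` (item stmt-BirchSwinnertonDyer-23599), line `rtt_w3` v13 — E2, row D2 (D2-b, LEAD g9 GO
# 14:01:41Z): JLK's `Thm52Shape` on a two-variable `ZetaSkeleton` over `𝒪⟦T₂⟧⟦T₁⟧` SPECIALISES along the inner evaluation `φ_b` (`f = C (X − C b)`) to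
# `char(H¹/Z mod f) · char(H²[f]) = char(H² mod f) · char((H¹/Z)[f])` over `𝒪⟦T⟧` — road D's E2-K identity BY NAME from the skeleton

Width seat `bsd-line-slh-p3-w3` g19 under LEAD `cruxlead-stmt-BirchSwinnertonDyer-23599` g9 (cell `bsd-ssimc`); ROUTE-INDEPENDENT helper
(`--supports stmt-BirchSwinnertonDyer-23599`); THEOREMS ONLY — no definition, no named fact, no instance, no `sorry`; nothing cohomological is
constructed (the skeleton is a HYPOTHESIS structure; JLK's theorem enters as the hypothesis `D.Thm52Shape`); closes nothing; BSD is not proved by any of this.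

WHAT. For any discrete valuation ring `𝒪`, `R = 𝒪⟦T₂⟧⟦T₁⟧` (`PowerSeries (PowerSeries 𝒪)` — the ring of `Rubin1991.IwasawaAlgebraO₂` / honda g22's
`TwistedIwasawaDataO.toZetaSkeleton`), a ring map `φ : R →+* 𝒪⟦T⟧` with the clauses of `exists_innerEval` (`φ (C (X − C b)) = 0`, `φ (C (C a)) = C a`,
`φ X = X`, `ker φ = (C (X − C b))`), and a `ZetaSkeleton R A H0 H1 H2` (JLK 2011 §5, tree `…EllipticUnits.ImaginaryQuadraticMainConjectureAllPrimes`) with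
`H1`, `H2` finitely generated:
* ★★ `charIdeal_specialisation_mul_eq_of_thm52Shape` — if `D.Thm52Shape` holds (clauses (1)–(3) + `char_R(H1 ⧸ Z) = char_R(H2)`) and `char_R(H2) ⊄ (f)`
  (`f`-regularity of the specialisation = «`f_ξ ∤ char`», E2K_tors), then with the `𝒪⟦T⟧`-structures by restriction along `ι = PowerSeries.map C`
  (explicit, as in p775349): `char(QuotSMulTop f (H1 ⧸ D.Z)) · char((H2)[f]) = char(QuotSMulTop f H2) · char((H1 ⧸ D.Z)[f])`
  — `…RttD2LambdaSpecialisationO.charIdeal_quotSMulTop_mul_eq_of_charIdeal_eq` fed from the skeleton (generator of the principal `char_R(H2)` by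
  `isPrincipal_charIdeal_of_ufm`, torsion witnesses from `Module.IsTorsion` by `Submodule.annihilator_top_inter_nonZeroDivisors`).
  With `(H1 ⧸ D.Z)[f] = ⊥` (the lever B1 of `…RttD2DescentAlgebra`) and the descent sequences (D2-seq) this is `char(𝐇¹_θ/∙z_θ) = char(𝐇²_θ)`, hence the
  glue's `hK` via `…RttE2KLambdaSocketGlue`.

References: [JohnsonLeungKings2011] Thm. 5.2, Cor. 5.3, Lemma 4.4; [BourbakiAC5to7] VII §4.5; [SkinnerUrban2014] Cor. 3.2.9.
-/

set_option autoImplicit false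
-- the Theorems namespace of this sub repeats the summit name by design (D-0017 nested layout)
set_option linter.dupNamespace false

noncomputable section

open scoped Pointwise

open PowerSeries Literature.NumberTheory.EllipticCurves Literature.NumberTheory.EllipticCurves.Module
open Literature.NumberTheory.ComplexMultiplication.EllipticUnits.JohnsonLeungKings2011
open Summit.BirchSwinnertonDyer.BirchSwinnertonDyer.Theorems.SignedBaseChangeAcDivSpecialization.LocalLength
  (isPrincipal_charIdeal_of_ufm)

namespace Summit.BirchSwinnertonDyer.BirchSwinnertonDyer.Theorems.SmallImageRttD2LamSpec

universe u v

variable {A : Type u} [CommRing A] [IsDomain A] [IsDiscreteValuationRing A] (b : A)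
  (φ : PowerSeries (PowerSeries A) →+* PowerSeries A)
  (hφf : φ (C (X - C b)) = 0) (hC : ∀ a : A, φ (C (C a)) = C a) (hX : φ X = X)
  (hker : RingHom.ker φ = Ideal.span {C (X - C b)})

include hφf hC hX hker in
/-- ★★ **JLK's `Thm52Shape` specialised along `φ_b`.** For a `ZetaSkeleton` `D` over `R = 𝒪⟦T₂⟧⟦T₁⟧` (`𝒪` a DVR) with `H1`, `H2` finitely generated,
`D.Thm52Shape` (in particular `char_R(H1 ⧸ Z) = char_R(H2)`, both torsion) and `f`-regularity `¬ char_R(H2) ≤ (f)`, `f = C (X − C b)`: with the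
`𝒪⟦T⟧`-structures the restriction along `ι = PowerSeries.map C`,
`char(QuotSMulTop f (H1 ⧸ D.Z)) · char(H2[f]) = char(QuotSMulTop f H2) · char((H1 ⧸ D.Z)[f])` as ideals of `𝒪⟦T⟧`.
[cite: JohnsonLeungKings2011, Thm. 5.2 and Cor. 5.3, Lemma 4.4] [cite: BourbakiAC5to7, VII §4.5] -/
theorem charIdeal_specialisation_mul_eq_of_thm52Shape {Aidx H0 H1 H2 : Type v} [AddCommGroup H0]
    [Module (PowerSeries (PowerSeries A)) H0] [AddCommGroup H1] [Module (PowerSeries (PowerSeries A)) H1] [AddCommGroup H2]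
    [Module (PowerSeries (PowerSeries A)) H2] [Module.Finite (PowerSeries (PowerSeries A)) H1] [Module.Finite (PowerSeries (PowerSeries A)) H2]
    (D : ZetaSkeleton (PowerSeries (PowerSeries A)) Aidx H0 H1 H2) (h52 : D.Thm52Shape)
    (hreg : ¬ charIdeal (PowerSeries (PowerSeries A)) H2 ≤ Ideal.span {(C (X - C b) : PowerSeries (PowerSeries A))}) :
    letI : Algebra (PowerSeries A) (PowerSeries (PowerSeries A)) := (PowerSeries.map (PowerSeries.C : A →+* PowerSeries A)).toAlgebra
    letI : Module (PowerSeries A) (H1 ⧸ D.Z) := Module.compHom (H1 ⧸ D.Z) (PowerSeries.map (PowerSeries.C : A →+* PowerSeries A))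
    letI : Module (PowerSeries A) H2 := Module.compHom H2 (PowerSeries.map (PowerSeries.C : A →+* PowerSeries A))
    haveI : IsScalarTower (PowerSeries A) (PowerSeries (PowerSeries A)) (H1 ⧸ D.Z) := IsScalarTower.of_algebraMap_smul fun _ _ ↦ rfl
    haveI : IsScalarTower (PowerSeries A) (PowerSeries (PowerSeries A)) H2 := IsScalarTower.of_algebraMap_smul fun _ _ ↦ rfl
    charIdeal (PowerSeries A) (QuotSMulTop (C (X - C b) : PowerSeries (PowerSeries A)) (H1 ⧸ D.Z)) *
        charIdeal (PowerSeries A) (Submodule.torsionBy (PowerSeries (PowerSeries A)) H2 (C (X - C b))) =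
      charIdeal (PowerSeries A) (QuotSMulTop (C (X - C b) : PowerSeries (PowerSeries A)) H2) *
        charIdeal (PowerSeries A) (Submodule.torsionBy (PowerSeries (PowerSeries A)) (H1 ⧸ D.Z) (C (X - C b))) := by
  haveI : UniqueFactorizationMonoid (PowerSeries (PowerSeries A)) :=
    Literature.NumberTheory.IwasawaTheory.uniqueFactorizationMonoid_powerSeries_powerSeries A
  obtain ⟨⟨-, -, htorsA, htorsB⟩, hchar⟩ := h52
  -- torsion witnesses
  obtain ⟨tA, htA, htA0⟩ := Submodule.annihilator_top_inter_nonZeroDivisors htorsA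
  obtain ⟨tB, htB, htB0⟩ := Submodule.annihilator_top_inter_nonZeroDivisors htorsB
  have htA' : ∀ m : H1 ⧸ D.Z, tA • m = 0 := fun m ↦ Submodule.mem_annihilator.mp htA m Submodule.mem_top
  have htB' : ∀ m : H2, tB • m = 0 := fun m ↦ Submodule.mem_annihilator.mp htB m Submodule.mem_top
  -- a generator of the (principal) characteristic ideal, not in `(f) = ker φ`
  obtain ⟨g, hg⟩ := (isPrincipal_charIdeal_of_ufm (R := PowerSeries (PowerSeries A)) (M := H2)).principal
  have hgB : charIdeal (PowerSeries (PowerSeries A)) H2 = Ideal.span {g} := hg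
  have hgA : charIdeal (PowerSeries (PowerSeries A)) (H1 ⧸ D.Z) = Ideal.span {g} := by
    rw [show charIdeal (PowerSeries (PowerSeries A)) (H1 ⧸ D.Z) = charIdeal (PowerSeries (PowerSeries A)) H2 from hchar, hgB]
  have hg0 : φ g ≠ 0 := by
    intro h0
    apply hreg
    rw [hgB, Ideal.span_singleton_le_iff_mem, ← hker]
    exact h0
  exact charIdeal_quotSMulTop_mul_eq_of_charIdeal_eq b φ hφf hC hX hker (H1 ⧸ D.Z) H2 (nonZeroDivisors.ne_zero htA0) htA'
    (nonZeroDivisors.ne_zero htB0) htB' hgA hchar hg0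

end Summit.BirchSwinnertonDyer.BirchSwinnertonDyer.Theorems.SmallImageRttD2LamSpec

end
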